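import Summits.HubbardSuperconductivity.HubbardSuperconductivity.Theses.AposterioriCapRg
import Literature.MathematicalPhysics.QuantumLattice.XYHelicalTwist

/-!
# Refutation of `AposterioriCapRg.KlsOrderOpenness` (stmt-HubbardSuperconductivity-1314): helical perturbations

`KlsOrderOpenness` (route `HubbardSuperconductivity/AposterioriCapRg`, rank-3 crux; the typed `η > 0`
core of the route's a-posteriori order criterion R) asserts: for every spin `n/2 ≥ 1/2` and range `r`
there is `ε₀ > 0` such that every translation-covariant, `U(1)`-invariant, range-`r`, norm-`≤ 1`
perturbation `ε W_L = ε Σ_x w_x`, `|ε| ≤ ε₀`, of the ferromagnetic quantum XY model on the even tori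
keeps the **momentum-zero** in-plane order parameter `(2k)⁻⁴ Σ_{x,y} Re ω(Sˣ_xSˣ_y + Sʸ_xSʸ_y) ≥ c > 0`.

This is false as typed, for `n = 1`, `r = 1` and EVERY `ε₀ > 0`: the Dzyaloshinskii–Moriya (helical)
bond term `Y_{ab} = Sˣ_aSʸ_b - Sʸ_aSˣ_b` is Hermitian, `U(1)` invariant, translation covariant and of
range `1`; with `θ⋆ = min(ε₀/4, 1/2)`, `m_L = ⌊Lθ⋆/2π⌋`, `θ_L = 2πm_L/L` the perturbation
`w_x = ε₀⁻¹ Σᵢ [(1 - cos θ_L) X_{x,x+eᵢ} - sin θ_L Y_{x,x+eᵢ}]` (spectrum in `[-5/16, 5/16]`) satisfies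
the EXACT gauge identity `H + ε₀ W_L = R H Rᴴ`, `R = ⨂_x diag(1, e^{iφ_x})`, `φ_x = q_L·x`,
`q_L = (m_L, m_L)` (`Literature…XYHelix.xyTorus_add_smul_wLoc`): the perturbation winds the order
into a spiral of pitch `θ_L ≈ θ⋆`, invisible at momentum zero. Hence
`Σ_{x,y} Re ω_ε(X_{xy}) = 2L² ĝ⁰(q_L)` (`XYHelix.sum_re_gsf_twisted`) and the tree's PROVED
Kennedy–Lieb–Shastry infrared bound gives `ĝ⁰(q_L) ≤ 1/(8(1 - cos(θ⋆/2))) + 1`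
(`XYHelix.xyStructureFactor_twistMom_le`), so the normalised order parameter is `O(L⁻²) → 0` and
no `c > 0` exists. All the matrix algebra is in
`Literature/MathematicalPhysics/QuantumLattice/XYHelicalTwist.lean`; this file only assembles.

ROUTE REPAIR (planner): the crux is mis-typed, not dead — pin the ordering wave vector, e.g. add
site-inversion covariance `reindexOp (Equiv.neg _) (w x) = w (-x)` to the perturbation class (the
DM term is inversion-odd; the field term `Σ Sᶻ_x` of the LSSY hard-core-boson instance survives),
or conclude with a gauge-invariant order (`∃ c > 0`, eventually `sup_q ĝ_L(q) ≥ c L²`, i.e. ODLRO of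
the one-body matrix `(ω(S⁺_xS⁻_y))_{x,y}`). The informal criterion R (stmt-1381) inherits the caveat.
Route review 2026-08-15, refuter-rreview-route-HubbardSuperconduc-90321f34-0.
-/

noncomputable section

namespace Summit.HubbardSuperconductivity.HubbardSuperconductivity.Theorems

open Matrix Complex Finset
open scoped ComplexOrder
open Literature.MathematicalPhysics.QuantumLattice Literature.Probability.LatticeModels
open Literature.MathematicalPhysics.QuantumLattice.XYHelix
open Summit.HubbardSuperconductivity.HubbardSuperconductivity.Theses.AposterioriCapRg

/-- **Record of the replaced/dropped route item `KlsOrderOpenness`** = stmt-HubbardSuperconductivity-1314 (ledger signature verbatim;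
NOT a route item): the route no longer declares this constant (repair by `restate`/`drop`), while
the theorem below — which closed the item at cfb05c66cfe1 and is indexed under this name —
still refers to it. Re-declared here under its original fully-qualified name and definiens solely
so that this record keeps elaborating (Theorems files are append-only: the theorem's statement
text may not change). It is FALSE as typed (helical Dzyaloshinskii–Moriya perturbations, see below); the route dropped it at rev 4–5. -/
def _root_.Summit.HubbardSuperconductivity.HubbardSuperconductivity.Theses.AposterioriCapRg.KlsOrderOpenness : Prop :=
    ∀ (n r : ℕ), 1 ≤ n → ∃ ε₀ : ℝ, 0 < ε₀ ∧ ∀ (W : ∀ L : ℕ,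
    Literature.MathematicalPhysics.QuantumLattice.Op (Literature.Probability.LatticeModels.TorusSite
    2 L) (n + 1)) (ε : ℝ), |ε| ≤ ε₀ → (∀ (L : ℕ) [NeZero L], ∃ w :
    Literature.Probability.LatticeModels.TorusSite 2 L →
    Literature.MathematicalPhysics.QuantumLattice.Op (Literature.Probability.LatticeModels.TorusSite
    2 L) (n + 1), W L = ∑ x, w x ∧ ∀ x, Literature.MathematicalPhysics.QuantumLattice.IsSupportedOn
    (w x) (Literature.MathematicalPhysics.QuantumLattice.torusBall x r) ∧ (∃ hw : Matrix.IsHermitian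
    (w x), ∀ i, |hw.eigenvalues i| ≤ 1) ∧ Commute (w x)
    (Literature.MathematicalPhysics.QuantumLattice.totalSpin n 2) ∧ ∀ v,
    Literature.MathematicalPhysics.QuantumLattice.reindexOp (Equiv.addRight v) (w x) = w (x + v)) →
    ∃ c : ℝ, 0 < c ∧ ∃ k₀ : ℕ, ∀ k : ℕ, k₀ ≤ k → ∀ [NeZero (2 * k)], c ≤ (∑ x :
    Literature.Probability.LatticeModels.TorusSite 2 (2 * k), ∑ y :
    Literature.Probability.LatticeModels.TorusSite 2 (2 * k),
    ((Literature.MathematicalPhysics.QuantumLattice.xyTorus 2 (2 * k) n + (ε : ℂ) • W (2 *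
    k)).groundStateFunctional (Literature.MathematicalPhysics.QuantumLattice.siteSpin n x 0 *
    Literature.MathematicalPhysics.QuantumLattice.siteSpin n y 0 +
    Literature.MathematicalPhysics.QuantumLattice.siteSpin n x 1 *
    Literature.MathematicalPhysics.QuantumLattice.siteSpin n y 1)).re) / ((2 * k : ℕ) : ℝ) ^ 4

/-- Refutes `AposterioriCapRg.KlsOrderOpenness` (stmt-HubbardSuperconductivity-1314): stability of
Kennedy–Lieb–Shastry XY order under ALL small translation-covariant `U(1)`-invariant finite-range
perturbations, measured at momentum zero, fails; witness: spin `1/2`, range `1`, for any `ε₀ > 0`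
the helical (Dzyaloshinskii–Moriya) perturbation `w_x = ε₀⁻¹ Σᵢ [(1 - cos θ_L) X_{x,x+eᵢ} -
sin θ_L Y_{x,x+eᵢ}]`, `θ_L = 2π⌊Lθ⋆/2π⌋/L`, `θ⋆ = min(ε₀/4, 1/2)`, for which `H + ε₀W_L = R H Rᴴ`
(commensurate twist) and the `q = 0` order parameter equals `2ĝ⁰(q_L)/L² = O(L⁻²)` by the KLS
infrared bound (`kls_xy_infraredBound_ground_holds`). [folklore] -/
theorem AposterioriCapRgKlsOrderOpenness_refuted :
    ¬ Summit.HubbardSuperconductivity.HubbardSuperconductivity.Theses.AposterioriCapRg.KlsOrderOpenness := by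
  intro hK
  obtain ⟨ε₀, hε₀, hmain⟩ := hK 1 1 le_rfl
  set θs : ℝ := min (ε₀ / 4) (1 / 2) with hθs_def
  have hθs0 : 0 < θs := lt_min (by linarith) (by norm_num)
  have hθs : θs ≤ 1 / 2 := min_le_right _ _
  have hθε : θs ≤ ε₀ / 4 := min_le_left _ _
  -- the perturbation family `W L = Σ_x w_x` (junk `0` on the degenerate side `L = 0`)
  set W : ∀ L : ℕ, Op (TorusSite 2 L) 2 := fun L =>
    if h : L = 0 then 0 else (haveI : NeZero L := ⟨h⟩; ∑ x, wLoc L ε₀ θs x) with hW_def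
  have hW : ∀ (L : ℕ) [NeZero L], W L = ∑ x, wLoc L ε₀ θs x := fun L _ => dif_neg (NeZero.ne L)
  -- admissibility
  obtain ⟨c, hc, k₀, hk⟩ := hmain W ε₀ (by rw [abs_of_pos hε₀]) (by
    intro L _
    refine ⟨wLoc L ε₀ θs, hW L, fun x => ⟨isSupportedOn_wLoc L ε₀ θs x, ?_,
      commute_wLoc_totalSpin L ε₀ θs x, reindexOp_addRight_wLoc L ε₀ θs x⟩⟩
    by_cases hL : 2 ≤ L
    · exact wLoc_eigenvalues L hL hε₀ hθs hθs0.le hθε x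
    · have h0 : wLoc L ε₀ θs x = 0 :=
        wLoc_eq_zero_of_twistNum L (twistNum_eq_zero L hθs (by omega)) ε₀ x
      rw [h0]
      refine ⟨isHermitian_zero, fun i => abs_eigenvalues_le_one _ ?_ ?_ i⟩
      · rw [sub_zero]; exact PosSemidef.one
      · rw [add_zero]; exact PosSemidef.one)
  -- the constant of the infrared bound
  set G : ℝ := 1 / (8 * (1 - Real.cos (θs / 2))) + 1 with hG
  have hη : 0 < 1 - Real.cos (θs / 2) := by
    have h := Real.cos_lt_cos_of_nonneg_of_le_pi (le_refl 0) (by linarith [Real.pi_gt_three])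
      (by linarith : (0 : ℝ) < θs / 2)
    rw [Real.cos_zero] at h
    linarith
  have hGpos : 0 < G := by positivity
  -- a large even side
  obtain ⟨N, hN⟩ := exists_nat_gt (4 * Real.pi / θs + G / c)
  set k : ℕ := N + k₀ + 2 with hk_def
  have hk₀ : k₀ ≤ k := by omega
  have hk2 : 2 ≤ k := by omega
  have hk1 : (1 : ℝ) ≤ k := by exact_mod_cast (by omega : 1 ≤ k)
  have hkN : (N : ℝ) ≤ k := by exact_mod_cast (by omega : N ≤ k)
  haveI : NeZero (2 * k) := ⟨by omega⟩
  have hL3 : 3 ≤ 2 * k := by omega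
  have hπθ : 0 ≤ 4 * Real.pi / θs := by positivity
  have hGc0 : 0 ≤ G / c := by positivity
  have hA : 4 * Real.pi / θs ≤ ((2 * k : ℕ) : ℝ) := by push_cast; linarith
  have hB : G / c < k := by linarith
  have hpitch : θs / 2 ≤ pitch θs (2 * k) := half_le_pitch hθs0 (2 * k) hA
  have hm : twistNum θs (2 * k) ≠ 0 := by
    intro h
    have : pitch θs (2 * k) = 0 := by rw [pitch, h]; simp
    linarith
  -- the conclusion of `KlsOrderOpenness` on the side `2k`
  have hmain' := hk k hk₀
  rw [hW (2 * k)] at hmain'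
  have hsum := sum_re_gsf_twisted (2 * k) hε₀.ne' hθs hθs0.le hL3
  simp only [xyPair] at hsum
  rw [hsum] at hmain'
  have hgle := xyStructureFactor_twistMom_le hθs hθs0 k hk2 hm hpitch
  -- `c ≤ 2 ĝ / L² ≤ 2 G / L² < c`
  have hLr : ((2 * k : ℕ) : ℝ) = 2 * (k : ℝ) := by push_cast; ring
  rw [hLr] at hmain'
  have hkpos : (0 : ℝ) < k := by linarith
  have e : 2 * (2 * (k : ℝ)) ^ 2 * xyStructureFactor 0 (2 * k) 1 (twistMom θs (2 * k)) /
      (2 * (k : ℝ)) ^ 4 = xyStructureFactor 0 (2 * k) 1 (twistMom θs (2 * k)) / (2 * (k : ℝ) ^ 2) := by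
    field_simp
  rw [e, le_div_iff₀ (by positivity)] at hmain'
  have hGc : G < c * k := by
    have := hB
    rwa [div_lt_iff₀ hc, mul_comm] at this
  nlinarith

end Summit.HubbardSuperconductivity.HubbardSuperconductivity.Theorems
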